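import Literature.Computability.AlgebraicComplexity.KIReductionBricksLevels
import HarnessLib

/-!
# Kabanets–Impagliazzo, Cor. 12: the reduction machine, V — level `0`, the evaluation identity, the word

Ninth file of the discharge of the reduction fact
`Literature.Computability.AlgebraicComplexity.permanent01Graph_polyExists_preimage_PIT`
(`PermanentGraphNSUBEXP.lean`), continuing `KIReductionBricksLevels.lean`:

* `levelQ` and `length_levelSuccPieceF_le` — the level piece is within its clip (the round context
  has length `≤ 3 (|w₀| + 3)⁴`), so the LEVELS fold `levelsF` writes levels `1, …, n`
  (`levelsF_apply`);
* `level0F` — the code of `level0Gates` (`level0F_apply`); `finalF` — the code of `finalGates` at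
  the parsed matrix `parsedM w₀` and value `vOf w₀` (`finalF_apply`);
* `itemsF`, `headerF`, `outOpF`, **`wordF`** and **`wordF_apply`**:
  `wordF w₀ = circuitWord (n²) (kiCircuit n (parsedM w₀) (vOf w₀) (blocksOf w₀))`, with
  `wordF_mem_FP`.

## References

* V. Kabanets, R. Impagliazzo, *Derandomizing polynomial identity tests means proving circuit
  lower bounds*, STOC 2003, Lemma 11 and proof of Cor. 12 (p. 358).
* S. Arora, B. Barak, *Computational Complexity: A Modern Approach*, CUP 2009, §1.3.
-/

noncomputable section

namespace Literature.Computability.AlgebraicComplexity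

namespace KIReduction

open _root_.Computability Complexity Brick OracleCompose HashBricks Plumb Polynomial ArithCircuit

/-! ### The level piece is within its clip -/

/-- `⟨c, w⟩ = ⟨c, ε⟩ ++ w` (private copy of a generic lemma held outside this file's import cone:
`FarCertMachine.boolPair_eq_append`, `Algebra/EuclideanLattices/FarCertMachineCodes.lean`). [folklore] -/
private theorem boolPair_eq_frame_append₂ (c w : List Bool) : boolPair c w = boolPair c [] ++ w := by
  simp [boolPair, List.append_assoc]


/-- The bound of the round context in the input length. [folklore] -/
def ctxBQ : Polynomial ℕ := 3 * (X + 3) ^ 4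

/-- The clip polynomial of the levels fold. [folklore] -/
def levelQ : Polynomial ℕ :=
  (8 + X * rowQ.comp (2 * X + 2) + X * (12 * (2 * (X * (X + 3) ^ 3) + X + 4) + 202)) +
    X * roundQ.comp ctxBQ + (4 * (2 * (2 * X ^ 2 + 6 * X + 2)) + 24 + 4 * ((X + 1) + (2 * X ^ 2 + 6 * X + 2)) + 120).comp ctxBQ

/-- The round context of the run is short: `|ctxR w₀ i'| ≤ 3 (|w₀| + 3)⁴` (`i' + 1 ≤ n`). [folklore] -/
theorem length_ctxR_le (w₀ : List Bool) {i' : ℕ} (hi : i' + 1 ≤ nOf w₀) : (ctxR w₀ i').length ≤ 3 * (w₀.length + 3) ^ 4 := by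
  have hn := nOf_le w₀
  have hG := levelBase_le_mul_cube w₀ (i := i' + 1) (by omega)
  have hN : nOf w₀ * nOf w₀ ≤ w₀.length * w₀.length := Nat.mul_le_mul hn hn
  have h1 := Sz_le w₀ (i' + 1)
  have h2 := Sz_le w₀ i'
  have hG' : levelBase (nOf w₀) (blocksOf w₀) (i' + 1) ≤ w₀.length * (w₀.length + 3) ^ 3 :=
    hG.trans (Nat.mul_le_mul_right _ (by omega))
  rw [length_ctxR]
  nlinarith [Nat.zero_le (w₀.length)]

/-- **The level piece is within the clip** (`i' + 1 ≤ n`). [folklore] -/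
theorem length_levelSuccPieceF_le (w₀ : List Bool) {i' : ℕ} (hi : i' + 1 ≤ nOf w₀) :
    (levelSuccPieceF (boolPair w₀ (ones i'))).length ≤ levelQ.eval w₀.length := by
  set L := w₀.length with hL
  have hn := nOf_le w₀
  have hiw : i' ≤ w₀.length := by omega
  have hC := length_ctxR_le w₀ hi
  have hend := endRecF_apply w₀ hiw
  have hU : (uStr w₀).length = nOf w₀ := rfl
  have hG := levelBase_le_mul_cube w₀ (i := i' + 1) (by omega)
  have hG' : levelBase (nOf w₀) (blocksOf w₀) (i' + 1) ≤ L * (L + 3) ^ 3 := hG.trans (Nat.mul_le_mul_right _ (by omega))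
  -- the use
  have huse : (levelUseF (boolPair w₀ (ones i'))).length ≤
      8 + L * rowQ.eval (2 * L + 2) + L * (12 * (2 * (L * (L + 3) ^ 3) + L + 4) + 202) := by
    rw [levelUseF, Function.comp_apply]
    simp only [fanoutFn_apply, Function.comp_apply, hend, ugR_ctxR, fstF_boolPair, sndF_boolPair, true_cons_ones,
      bsF_apply, uF_apply, lenBinF_apply, List.length_append, List.length_singleton, length_ones']
    refine (length_useF_le (opShort_idOpF (uStr w₀) []) _ _).trans ?_
    have hBs : (bsStr w₀ (i' + 1)).length ≤ L := length_bsStr_le w₀ _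
    have hbin : (encodeNat (levelBase (nOf w₀) (blocksOf w₀) (i' + 1) + 1)).length ≤ L * (L + 3) ^ 3 + 1 :=
      (length_encodeNat_le_self _).trans (by omega)
    have hctx : (boolPair (uStr w₀) []).length ≤ 2 * L + 2 := by simp only [length_boolPair, List.length_nil, hU]; omega
    have e1 : (uStr w₀).length * rowQ.eval (boolPair (uStr w₀) []).length ≤ L * rowQ.eval (2 * L + 2) :=
      Nat.mul_le_mul (hU ▸ hn) (TM2Iter.eval_mono rowQ hctx)
    have hp : (boolPair (encodeNat (levelBase (nOf w₀) (blocksOf w₀) (i' + 1) + 1)) (bsStr w₀ (i' + 1))).length ≤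
        2 * (L * (L + 3) ^ 3) + L + 4 := by simp only [length_boolPair]; omega
    have e2 : (bsStr w₀ (i' + 1)).length *
        (12 * (boolPair (encodeNat (levelBase (nOf w₀) (blocksOf w₀) (i' + 1) + 1)) (bsStr w₀ (i' + 1))).length + 202) ≤
          L * (12 * (2 * (L * (L + 3) ^ 3) + L + 4) + 202) := Nat.mul_le_mul hBs (by omega)
    omega
  -- the rounds
  have hrounds : (foldCat roundQ (X + 1) roundPieceF (boolPair (ctxR w₀ i') (ones (i' + 1)))).length ≤
      L * roundQ.eval (3 * (L + 3) ^ 4) := by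
    have hQ : ∀ t, t < (ones (i' + 1)).length → (roundPieceF (boolPair (ctxR w₀ i') (ones t))).length ≤ roundQ.eval (ctxR w₀ i').length :=
      fun t ht => length_roundPieceF_le w₀ hi (by simpa using ht)
    rw [foldCat_apply (p := X + 1) (by simp; exact (le_length_ctxR w₀ i').2.1) hQ]
    refine (length_ccat_le' _ hQ).trans ?_
    rw [length_ones']
    exact Nat.mul_le_mul (by omega) (TM2Iter.eval_mono roundQ hC)
  -- the closing gates
  have hclose : (closeF (boolPair (ctxR w₀ i') (ones (i' + 1)))).length ≤
      (4 * (2 * (2 * X ^ 2 + 6 * X + 2)) + 24 + 4 * ((X + 1) + (2 * X ^ 2 + 6 * X + 2)) + 120 : Polynomial ℕ).eval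
        (3 * (L + 3) ^ 4) := by
    have hr := roundBase_le_ctxR w₀ (i' := i') (j := i' + 1) le_rfl
    set C := (ctxR w₀ i').length
    have a := length_gateOpF_le (List.tail ∘ rUF) (boolPair (ctxR w₀ i') (ones (i' + 1)))
    have b := length_gateOpF_le (List.tail ∘ ugR) (boolPair (ctxR w₀ i') (ones (i' + 1)))
    have c := length_gateOpF_le rUF (boolPair (ctxR w₀ i') (ones (i' + 1)))
    simp only [Function.comp_apply, rUF_ctxR, ugR_ctxR, List.length_tail, length_ones'] at a b c
    have hGC := (le_length_ctxR w₀ i').2.2.1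
    have step : (closeF (boolPair (ctxR w₀ i') (ones (i' + 1)))).length ≤
        4 * (2 * (2 * C ^ 2 + 6 * C + 2)) + 24 + 4 * ((C + 1) + (2 * C ^ 2 + 6 * C + 2)) + 120 := by
      rw [closeF, List.length_append, length_prod2F, length_sum2F]
      have i1 : (intCode 1).length = 5 := by simp [intCode_one]
      omega
    refine step.trans ?_
    have mono := TM2Iter.eval_mono (4 * (2 * (2 * X ^ 2 + 6 * X + 2)) + 24 + 4 * ((X + 1) + (2 * X ^ 2 + 6 * X + 2)) + 120 : Polynomial ℕ) hC
    simp only [Polynomial.eval_add, Polynomial.eval_mul, Polynomial.eval_pow, Polynomial.eval_X, Polynomial.eval_ofNat,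
      Polynomial.eval_one] at mono ⊢
    exact mono
  rw [levelSuccPieceF]
  simp only [Function.comp_apply, hend, List.length_append]
  simp only [levelQ, ctxBQ, Polynomial.eval_add, Polynomial.eval_mul, Polynomial.eval_pow, Polynomial.eval_X,
    Polynomial.eval_ofNat, Polynomial.eval_comp, Polynomial.eval_one] at hclose ⊢
  omega

/-- **The levels brick**: the fold of the level pieces over `n` rounds (`u = uStr w₀`). [cite: KabanetsImpagliazzo2003, Lemma 11 (p. 358)] -/
def levelsF : List Bool → List Bool := foldCat levelQ X levelSuccPieceF ∘ fanoutFn id uF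

/-- `levelsF ∈ FP`. [folklore] -/
theorem levelsF_mem_FP : levelsF ∈ FP :=
  comp_mem_FP (foldCat_mem_FP _ _ levelSuccPieceF_mem_FP) (fanoutFn_mem_FP id_mem_FP uF_mem_FP)

/-- **Value of the levels brick**: the concatenation of the codes of levels `1, …, n`. [folklore] -/
theorem levelsF_apply (w₀ : List Bool) :
    levelsF w₀ = ccat (fun i' => encList ((levelSuccGates (nOf w₀) (blocksOf w₀) (i' + 1)
      (levelBase (nOf w₀) (blocksOf w₀) (i' + 1)) (.gate (levelBase (nOf w₀) (blocksOf w₀) (i' + 1) - 1))).map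
        (gateCode (nOf w₀ * nOf w₀)))) (nOf w₀) := by
  rw [levelsF, Function.comp_apply, fanoutFn_apply, id, uF_apply,
    foldCat_apply (p := X) (by simp only [Polynomial.eval_X]; exact nOf_le w₀) (fun t ht => length_levelSuccPieceF_le w₀ ht)]
  exact ccat_congr fun i' hi => levelSuccPieceF_apply w₀ hi

/-! ### Level `0` -/

/-- `1^{|P 0|}` on `w₀`. [folklore] -/
def us0F : List Bool → List Bool := usF ∘ fanoutFn id (fun _ => [])
/-- `1^{useLen (P 0)}` on `w₀`. [folklore] -/
def uL0F : List Bool → List Bool := fun z => (unF z ++ us0F z) ++ [true]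

/-- **The level-`0` brick**: the use of `P 0` behind the identity layer at offset `0`, the
identity `Q₀ − 1`, its square, the first running sum `0 + square`. [cite: KabanetsImpagliazzo2003, Lemma 11 (1) (p. 358)] -/
def level0F : List Bool → List Bool :=
  fun z => ((useF idOpF ∘ fanoutFn (fanoutFn (fun _ => encodeNat 1) (bsF ∘ fanoutFn id (fun _ => []))) (fanoutFn uF (fun _ => []))) z ++
    sum2F 1 (-1) (gateOpF fun z => unF z ++ us0F z) (fun _ => oneOpCode) z) ++
      (prod2F (gateOpF uL0F) (gateOpF uL0F) z ++ sum2F 1 1 (fun _ => zeroOpCode) (gateOpF fun z => uL0F z ++ [true]) z)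

/-- `us0F ∈ FP`. [folklore] -/
theorem us0F_mem_FP : us0F ∈ FP := comp_mem_FP usF_mem_FP (fanoutFn_mem_FP id_mem_FP (const_mem_FP _))
/-- `uL0F ∈ FP`. [folklore] -/
theorem uL0F_mem_FP : uL0F ∈ FP := append_mem_FP (append_mem_FP unF_mem_FP us0F_mem_FP) (const_mem_FP _)

/-- `level0F ∈ FP`. [folklore] -/
theorem level0F_mem_FP : level0F ∈ FP :=
  append_mem_FP
    (append_mem_FP (comp_mem_FP (useF_mem_FP idOpF_mem_FP) (fanoutFn_mem_FP (fanoutFn_mem_FP (const_mem_FP _)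
        (comp_mem_FP bsF_mem_FP (fanoutFn_mem_FP id_mem_FP (const_mem_FP _)))) (fanoutFn_mem_FP uF_mem_FP (const_mem_FP _))))
      (sum2F_mem_FP 1 (-1) (gateOpF_mem_FP (append_mem_FP unF_mem_FP us0F_mem_FP)) (const_mem_FP _)))
    (append_mem_FP (prod2F_mem_FP (gateOpF_mem_FP uL0F_mem_FP) (gateOpF_mem_FP uL0F_mem_FP))
      (sum2F_mem_FP 1 1 (const_mem_FP _) (gateOpF_mem_FP (append_mem_FP uL0F_mem_FP (const_mem_FP _)))))

/-- Value of `us0F`. [folklore] -/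
@[simp] theorem us0F_apply (w₀ : List Bool) : us0F w₀ = ones (Sz w₀ 0) := by simp [us0F]
/-- Value of `uL0F`. [folklore] -/
@[simp] theorem uL0F_apply (w₀ : List Bool) : uL0F w₀ = ones (useLen (nOf w₀) (blocksOf w₀ 0)) := by
  simp only [uL0F, unF_apply, us0F_apply, ones_useLen]

/-- **Value of the level-`0` brick**: the list code of the codes of `level0Gates n P 0 (const 0)`. [cite: KabanetsImpagliazzo2003, Lemma 11 (1) (p. 358)] -/
theorem level0F_apply (w₀ : List Bool) :
    level0F w₀ = encList ((level0Gates (nOf w₀) (blocksOf w₀) 0 (.const 0)).map (gateCode (nOf w₀ * nOf w₀))) := by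
  set n := nOf w₀ with hn
  set P := blocksOf w₀ with hP
  have hU : (uStr w₀).length = n := rfl
  have huse : (useF idOpF ∘ fanoutFn (fanoutFn (fun _ => encodeNat 1) (bsF ∘ fanoutFn id (fun _ => []))) (fanoutFn uF (fun _ => []))) w₀ =
      encList ((useGates 0 (idL n) (P 0)).map (gateCode (n * n))) := by
    simp only [Function.comp_apply, fanoutFn_apply, id, bsF_apply, List.length_nil, uF_apply]
    rw [show encodeNat 1 = encodeNat (0 + 1) from rfl,
      useF_apply (U := uStr w₀) (prm := []) (opShort_idOpF (uStr w₀) []) (L := idL n)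
        (fun a b ha hb => idOpF_apply (uStr w₀) [] ha hb) 0 (bsStr w₀ 0)]
    rfl
  have he : sum2F 1 (-1) (gateOpF fun z => unF z ++ us0F z) (fun _ => oneOpCode) w₀ =
      boolPair (gateCode (n * n) (.sum [(1, .gate (0 + useOut (n * n) (P 0))), (-1, .const 1)])) [] := by
    refine sum2F_apply 1 (-1) ?_ rfl
    rw [gateOpF_apply (n * n)]
    simp [useOut, Sz, ← hn, ← hP]
  have hsq : prod2F (gateOpF uL0F) (gateOpF uL0F) w₀ =
      boolPair (gateCode (n * n) (.prod [.gate (0 + useLen n (P 0)), .gate (0 + useLen n (P 0))])) [] := by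
    have h1 : gateOpF uL0F w₀ = opCode (n * n) (.gate (0 + useLen n (P 0))) := by
      rw [gateOpF_apply (n * n), uL0F_apply]; simp [← hn, ← hP]
    exact prod2F_apply h1 h1
  have hacc : sum2F 1 1 (fun _ => zeroOpCode) (gateOpF fun z => uL0F z ++ [true]) w₀ =
      boolPair (gateCode (n * n) (.sum [(1, .const 0), (1, .gate (0 + useLen n (P 0) + 1))])) [] := by
    refine sum2F_apply 1 1 rfl ?_
    rw [gateOpF_apply (n * n)]
    simp [← hn, ← hP]
  rw [level0F, huse, he, hsq, hacc, level0Gates, List.map_append, encList_append, List.map_cons, List.map_cons,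
    List.map_cons, List.map_nil, encList_cons, encList_pair, boolPair_eq_frame_append₂ _ (boolPair _ [] ++ _), List.append_assoc]

/-! ### The evaluation identity -/

/-- The parsed input matrix (entries `0/1`, read off the rows field). [cite: KabanetsImpagliazzo2003, proof of Cor. 12 (p. 358)] -/
def parsedM (w₀ : List Bool) : Fin (nOf w₀) → Fin (nOf w₀) → ℤ := fun a b => parsedEntry (rowsStr w₀) a.val b.val

/-- `1^{G_{n+1}}` on `w₀`: the offset fold over `n + 1` rounds. [folklore] -/
def ugFF : List Bool → List Bool := baseF ∘ fanoutFn id (List.cons true ∘ uF)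
/-- `1^{|P n|}` on `w₀`. [folklore] -/
def usnF : List Bool → List Bool := usF ∘ fanoutFn id uF
/-- `1^{useLen (P n)}` on `w₀`. [folklore] -/
def uLnF : List Bool → List Bool := fun z => (unF z ++ usnF z) ++ [true]

/-- `ugFF ∈ FP`. [folklore] -/
theorem ugFF_mem_FP : ugFF ∈ FP := comp_mem_FP baseF_mem_FP (fanoutFn_mem_FP id_mem_FP (comp_mem_FP (cons_mem_FP true) uF_mem_FP))
/-- `usnF ∈ FP`. [folklore] -/
theorem usnF_mem_FP : usnF ∈ FP := comp_mem_FP usF_mem_FP (fanoutFn_mem_FP id_mem_FP uF_mem_FP)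
/-- `uLnF ∈ FP`. [folklore] -/
theorem uLnF_mem_FP : uLnF ∈ FP := append_mem_FP (append_mem_FP unF_mem_FP usnF_mem_FP) (const_mem_FP _)

/-- Value of `ugFF`. [folklore] -/
@[simp] theorem ugFF_apply (w₀ : List Bool) : ugFF w₀ = ones (levelBase (nOf w₀) (blocksOf w₀) (nOf w₀ + 1)) := by
  rw [ugFF, Function.comp_apply, fanoutFn_apply, id, Function.comp_apply, uF_apply,
    baseF_apply w₀ _ (by simp only [List.length_cons]; exact Nat.succ_le_succ (nOf_le w₀))]
  rfl
/-- Value of `usnF`. [folklore] -/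
@[simp] theorem usnF_apply (w₀ : List Bool) : usnF w₀ = ones (Sz w₀ (nOf w₀)) := by simp [usnF]; rfl
/-- Value of `uLnF`. [folklore] -/
@[simp] theorem uLnF_apply (w₀ : List Bool) : uLnF w₀ = ones (useLen (nOf w₀) (blocksOf w₀ (nOf w₀))) := by
  simp only [uLnF, unF_apply, usnF_apply, ones_useLen]

/-- **The evaluation-identity brick**: the use of `P n` behind the constant layer of the parsed
matrix at offset `G_{n+1}`, the identity `Qₙ(M) − v`, its square, the last running sum. [cite: KabanetsImpagliazzo2003, proof of Cor. 12 (p. 358)] -/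
def finalF : List Bool → List Bool :=
  fun z => ((useF constOpF ∘ fanoutFn (fanoutFn (lenBinF ∘ fun z => ugFF z ++ [true]) (bsF ∘ fanoutFn id uF)) (fanoutFn uF rowsF)) z ++
    sum2F 1 (-1) (gateOpF fun z => (ugFF z ++ unF z) ++ usnF z) (constVOpF id) z) ++
      (prod2F (gateOpF fun z => ugFF z ++ uLnF z) (gateOpF fun z => ugFF z ++ uLnF z) z ++
        sum2F 1 1 (gateOpF (List.tail ∘ ugFF)) (gateOpF fun z => (ugFF z ++ uLnF z) ++ [true]) z)

/-- `finalF ∈ FP`. [folklore] -/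
theorem finalF_mem_FP : finalF ∈ FP :=
  append_mem_FP
    (append_mem_FP (comp_mem_FP (useF_mem_FP constOpF_mem_FP) (fanoutFn_mem_FP
        (fanoutFn_mem_FP (comp_mem_FP lenBinF_mem_FP (append_mem_FP ugFF_mem_FP (const_mem_FP _)))
          (comp_mem_FP bsF_mem_FP (fanoutFn_mem_FP id_mem_FP uF_mem_FP))) (fanoutFn_mem_FP uF_mem_FP rowsF_mem_FP)))
      (sum2F_mem_FP 1 (-1) (gateOpF_mem_FP (append_mem_FP (append_mem_FP ugFF_mem_FP unF_mem_FP) usnF_mem_FP)) (constVOpF_mem_FP id_mem_FP)))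
    (append_mem_FP (prod2F_mem_FP (gateOpF_mem_FP (append_mem_FP ugFF_mem_FP uLnF_mem_FP)) (gateOpF_mem_FP (append_mem_FP ugFF_mem_FP uLnF_mem_FP)))
      (sum2F_mem_FP 1 1 (gateOpF_mem_FP (comp_mem_FP PRelSigma.tail_mem_FP ugFF_mem_FP))
        (gateOpF_mem_FP (append_mem_FP (append_mem_FP ugFF_mem_FP uLnF_mem_FP) (const_mem_FP _)))))

/-- **Value of the evaluation-identity brick**: the list code of the codes of
`finalGates n (parsedM w₀) (vOf w₀) P G_{n+1} (gate (G_{n+1} − 1))`. [cite: KabanetsImpagliazzo2003, proof of Cor. 12 (p. 358)] -/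
theorem finalF_apply (w₀ : List Bool) :
    finalF w₀ = encList ((finalGates (nOf w₀) (parsedM w₀) (vOf w₀) (blocksOf w₀)
      (levelBase (nOf w₀) (blocksOf w₀) (nOf w₀ + 1)) (.gate (levelBase (nOf w₀) (blocksOf w₀) (nOf w₀ + 1) - 1))).map
        (gateCode (nOf w₀ * nOf w₀))) := by
  set n := nOf w₀ with hn
  set P := blocksOf w₀ with hP
  set G := levelBase n P (n + 1) with hG
  have hU : (uStr w₀).length = n := rfl
  have huse : (useF constOpF ∘ fanoutFn (fanoutFn (lenBinF ∘ fun z => ugFF z ++ [true]) (bsF ∘ fanoutFn id uF)) (fanoutFn uF rowsF)) w₀ =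
      encList ((useGates G (constLayer n (parsedM w₀)) (P n)).map (gateCode (n * n))) := by
    simp only [Function.comp_apply, fanoutFn_apply, id, bsF_apply, uF_apply, rowsF_apply, ugFF_apply, lenBinF_apply,
      List.length_append, List.length_singleton, length_ones']
    rw [← hn, ← hP, ← hG,
      useF_apply (U := uStr w₀) (prm := rowsStr w₀) (opShort_constOpF (uStr w₀) (rowsStr w₀)) (L := constLayer n (parsedM w₀))
        (fun a b ha hb => constOpF_apply (uStr w₀) (rowsStr w₀) ha hb) G (bsStr w₀ (uStr w₀).length)]
    rfl
  have he : sum2F 1 (-1) (gateOpF fun z => (ugFF z ++ unF z) ++ usnF z) (constVOpF id) w₀ =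
      boolPair (gateCode (n * n) (.sum [(1, .gate (G + useOut (n * n) (P n))), (-1, .const (vOf w₀ : ℤ))])) [] := by
    refine sum2F_apply 1 (-1) ?_ (constVOpF_apply (n * n) w₀ rfl)
    rw [gateOpF_apply (n * n)]
    simp [useOut, Sz, ← hn, ← hP, ← hG, Nat.add_assoc]
  have hg : gateOpF (fun z => ugFF z ++ uLnF z) w₀ = opCode (n * n) (.gate (G + useLen n (P n))) := by
    rw [gateOpF_apply (n * n)]; simp [← hn, ← hP, ← hG]
  have hacc : sum2F 1 1 (gateOpF (List.tail ∘ ugFF)) (gateOpF fun z => (ugFF z ++ uLnF z) ++ [true]) w₀ =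
      boolPair (gateCode (n * n) (.sum [(1, .gate (G - 1)), (1, .gate (G + useLen n (P n) + 1))])) [] := by
    refine sum2F_apply 1 1 ?_ ?_
    · rw [gateOpF_apply (n * n)]; simp [← hn, ← hP, ← hG]
    · rw [gateOpF_apply (n * n)]; simp [← hn, ← hP, ← hG]
  rw [finalF, huse, he, prod2F_apply hg hg, hacc, finalGates, List.map_append, encList_append, List.map_cons, List.map_cons,
    List.map_cons, List.map_nil, encList_cons, encList_pair, boolPair_eq_frame_append₂ _ (boolPair _ [] ++ _), List.append_assoc]

/-! ### The word -/

/-- All levels are level `0` followed by the concatenation of the levels `1, …, m`. [folklore] -/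
theorem encList_map_allLevelGates (n : ℕ) (P : ℕ → KBlock) : ∀ m,
    encList ((allLevelGates n P m).map (gateCode (n * n))) =
      encList ((level0Gates n P 0 (.const 0)).map (gateCode (n * n))) ++
        ccat (fun i' => encList ((levelSuccGates n P (i' + 1) (levelBase n P (i' + 1)) (.gate (levelBase n P (i' + 1) - 1))).map
          (gateCode (n * n)))) m
  | 0 => by simp [allLevelGates]
  | m + 1 => by
    rw [show allLevelGates n P (m + 1) = allLevelGates n P m ++ levelSuccGates n P (m + 1) (levelBase n P (m + 1))
        (.gate (levelBase n P (m + 1) - 1)) from rfl, List.map_append, encList_append, encList_map_allLevelGates n P m, ccat_succ,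
      List.append_assoc]

/-- **The items brick**: level `0`, the levels, the evaluation identity. [cite: KabanetsImpagliazzo2003, proof of Cor. 12 (p. 358)] -/
def itemsF : List Bool → List Bool := fun z => (level0F z ++ levelsF z) ++ finalF z

/-- `itemsF ∈ FP`. [folklore] -/
theorem itemsF_mem_FP : itemsF ∈ FP := append_mem_FP (append_mem_FP level0F_mem_FP levelsF_mem_FP) finalF_mem_FP

/-- **Value of the items brick**: the list code of the gate codes of the instance. [folklore] -/
theorem itemsF_apply (w₀ : List Bool) :
    itemsF w₀ = encList ((kiCircuit (nOf w₀) (parsedM w₀) (vOf w₀) (blocksOf w₀)).gates.map (gateCode (nOf w₀ * nOf w₀))) := by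
  rw [itemsF, level0F_apply, levelsF_apply, finalF_apply, kiCircuit_gates, List.map_append, encList_append,
    encList_map_allLevelGates]

/-- The header `1^{#gates}`: `1^{G_{n+1}} ++ 1^{useLen (P n)} ++ 111`. [folklore] -/
def headerF : List Bool → List Bool := fun z => (ugFF z ++ uLnF z) ++ [true, true, true]
/-- The output operand: `gate (G_{n+1} + useLen (P n) + 2)`. [folklore] -/
def outOpF : List Bool → List Bool := gateOpF fun z => (ugFF z ++ uLnF z) ++ [true, true]

/-- `headerF ∈ FP`. [folklore] -/
theorem headerF_mem_FP : headerF ∈ FP := append_mem_FP (append_mem_FP ugFF_mem_FP uLnF_mem_FP) (const_mem_FP _)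
/-- `outOpF ∈ FP`. [folklore] -/
theorem outOpF_mem_FP : outOpF ∈ FP := gateOpF_mem_FP (append_mem_FP (append_mem_FP ugFF_mem_FP uLnF_mem_FP) (const_mem_FP _))

/-- Value of the header: `1^{#gates}`. [folklore] -/
theorem headerF_apply (w₀ : List Bool) :
    headerF w₀ = ones (levelBase (nOf w₀) (blocksOf w₀) (nOf w₀ + 1) + useLen (nOf w₀) (blocksOf w₀ (nOf w₀)) + 3) := by
  rw [headerF, ugFF_apply, uLnF_apply, show [true, true, true] = ones 3 from rfl, Com.ones_append, Com.ones_append]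

/-- Value of the output operand: `gate (G_{n+1} + useLen (P n) + 2)`. [folklore] -/
theorem outOpF_apply (w₀ : List Bool) :
    outOpF w₀ = opCode (nOf w₀ * nOf w₀)
      (.gate (levelBase (nOf w₀) (blocksOf w₀) (nOf w₀ + 1) + useLen (nOf w₀) (blocksOf w₀ (nOf w₀)) + 2)) := by
  rw [outOpF, gateOpF_apply (nOf w₀ * nOf w₀), ugFF_apply, uLnF_apply, show [true, true] = ones 2 from rfl, Com.ones_append,
    Com.ones_append, length_ones']

/-- **The word brick**: `⟨bin n², ⟨⟨1^{#gates}, items⟩, output⟩⟩`. [cite: KabanetsImpagliazzo2004, §2] -/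
def wordF : List Bool → List Bool := fanoutFn (lenBinF ∘ unF) (fanoutFn (fanoutFn headerF itemsF) outOpF)

/-- **`wordF ∈ FP`.** [cite: AroraBarakCC2009, §1.3] -/
theorem wordF_mem_FP : wordF ∈ FP :=
  fanoutFn_mem_FP (comp_mem_FP lenBinF_mem_FP unF_mem_FP) (fanoutFn_mem_FP (fanoutFn_mem_FP headerF_mem_FP itemsF_mem_FP) outOpF_mem_FP)

/-- **Value of the word brick**: the `PITLanguage` word of the instance on the parsed input and
the guess. [cite: KabanetsImpagliazzo2003, proof of Cor. 12 (p. 358)] -/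
theorem wordF_apply (w₀ : List Bool) :
    wordF w₀ = circuitWord (nOf w₀ * nOf w₀) (kiCircuit (nOf w₀) (parsedM w₀) (vOf w₀) (blocksOf w₀)) := by
  rw [circuitWord, encodeArithCircuit_eq, ← itemsF_apply, length_kiCircuit_gates, kiCircuit_output, wordF]
  simp only [fanoutFn_apply, Function.comp_apply, unF_apply, lenBinF_apply, length_ones', headerF_apply, outOpF_apply]

end KIReduction

end Literature.Computability.AlgebraicComplexity

end
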